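import Mathlib
import Summits.ValiantsHypothesis.ValiantsHypothesis.Theorems.NewtonUnitEquationsDissociatedUniformStubExposedGenericDirection
import Summits.ValiantsHypothesis.ValiantsHypothesis.Theorems.NewtonUnitEquationsNewtonTauWeakResidueDesignHull

/-!
# `NewtonUnitEquationsNewtonTauWeakResidueWeightedHull` — THEOREM G'': hull vertices of weighted-residue level sets, from the normal form

Registered stub `stub_residueWeightedHullOfNF` of line `binomial-normal-form` (crux `NewtonTauWeak`,
stmt-ValiantsHypothesis-5904, lead c6): the assembly of THEOREM G'' (the weighted-residue analogue of THEOREM G,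
`stub_residueDesignHull`) from its exchange normal form.

Setting.  Exponents `d j ∈ ℕ²` (`j : Fin N`, all nonzero), natural weights `g j`, a modulus `q ≥ 1` and a
residue `r`.  A set `J ⊆ Fin N` is *admissible* if `Σ_{j ∈ J} g j ≡ r (mod q)`, and
`X = {Σ_{j ∈ J} d j : J admissible} ⊆ ℕ²`.  For a value vector `c : Fin N → ℝ` and parameters `a b : ℕ → ℕ`
the *canonical set* `canon c a b` consists of the positives `0 < c j` of in-class rank `≥ b (g j % q)` for the
key `(c j, j)` and the negatives `c j < 0` of in-class rank `< a (g j % q)` for the key `(-c j, j)`, the classes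
being the residue classes `g j % q` (hypothesis `hcanon`; `canon` is a parameter).  The *normal form*
(hypothesis `hNF`, the weighted exchange argument) says: for every nowhere-zero `c` and every admissible `J`
maximising `Σ_J c j` among admissible sets there are `a b : ℕ → ℕ`, vanishing on `[q, ∞)` and with
`Σ_{h < q} (a h + b h) < q`, such that `canon c a b` is admissible with the same value `Σ c` as `J`.
Claim: the convex hull of `X ⊆ ℝ²` has at most `(4 (N² + N) + 5) q ^ (2 q)` extreme points.

Proof.
* (`ResidueWeightedHullAux.extremePoint_eq_canonical`)  An extreme point `e` of `conv X` is strictly exposed by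
  a direction `w` whose height `x ↦ ⟨w, x⟩` is moreover injective on `{0} ∪ {d j}`
  (`NewtonUnitEquationsDissociatedUniform.stub_exposedGenericDirection`), so the values `c j = ⟨w, d j⟩` are
  nonzero and `e = Σ_{J₀} d j` for an admissible `J₀` maximising `Σ_J c j` over admissible `J` (heights are
  additive).  By the normal form `hNF` the canonical set `canon c a b` (with `a h, b h < q` for all `h`, and
  `a h = b h = 0` for `q ≤ h`) is admissible with the same value, hence, exposure being strict,
  `Σ_{canon c a b} d j = e`.
* (`ResidueWeightedHullAux.canonical_eq_of_signs`)  `canon c a b` depends on `c` only through the signs of the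
  `N * N + N` numbers `c j' - c j`, `c j`, i.e. through the sign vector of the linear functionals
  `w ↦ ⟨w, d j' - d j⟩`, `w ↦ ⟨w, d j⟩` at `w`.
* (`ResidueDesignHullAux.signvec_plane_count`, THEOREM G)  `M` linear functionals on `ℝ²` realise at most
  `4 M + 5` sign vectors.
* (`stub_residueWeightedHullOfNF`)  The parameters `a`, `b` are the lifts (extension by `0`) of functions
  `Fin q → Fin q`, `q ^ q` of them each.  Hence the extreme points are images of triples (sign vector, `a`, `b`):
  at most `(4 (N * N + N) + 5) q ^ q q ^ q` of them.

Everything is folklore (planar convexity, arrangements on a line, counting); no named facts, no citations.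
No `def`s: the sign-vector map, the canonical-set map and the lift are written as explicit lambda terms.
-/

-- Sub = Summit single-conjunct layout: the duplicated namespace component is mandated by the tree.
set_option linter.dupNamespace false

noncomputable section

open scoped BigOperators

namespace Summit.ValiantsHypothesis.ValiantsHypothesis.Theorems.NewtonUnitEquationsNewtonTauWeak

namespace ResidueWeightedHullAux

/-- **The canonical set only depends on the sign vector.**  The canonical admissible set `canon c a b` of the
weighted normal form (positives `0 < c j` of in-class rank `≥ b (g j % q)` for the key `(c j, j)`, negatives
`c j < 0` of in-class rank `< a (g j % q)` for the key `(-c j, j)`, classes `g j % q`) is a function of the signs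
of the numbers `c j` and `c j' - c j` alone: reading these signs from a vector `v : Fin (N * N + N) → SignType`
(pairs `(j', j)` first, via `finProdFinEquiv`/`finSumFinEquiv`, then singletons `j`), `canon c a b` is the
displayed set `F(v, a, b)`. [folklore] -/
theorem canonical_eq_of_signs (N q : ℕ) (g : Fin N → ℕ) (c : Fin N → ℝ) (a b : ℕ → ℕ)
    (v : Fin (N * N + N) → SignType)
    (hvs : ∀ j, v (finSumFinEquiv (Sum.inr j)) = SignType.sign (c j))
    (hvp : ∀ j' j, v (finSumFinEquiv (Sum.inl (finProdFinEquiv (j', j)))) = SignType.sign (c j' - c j)) :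
    (Finset.univ.filter fun j : Fin N =>
        (0 < c j ∧ b (g j % q) ≤ (Finset.univ.filter fun j' : Fin N =>
            g j' % q = g j % q ∧ 0 < c j' ∧ (c j' < c j ∨ (c j' = c j ∧ j' < j))).card) ∨
        (c j < 0 ∧ (Finset.univ.filter fun j' : Fin N =>
            g j' % q = g j % q ∧ c j' < 0 ∧ (c j < c j' ∨ (c j' = c j ∧ j' < j))).card < a (g j % q))) =
      Finset.univ.filter fun j : Fin N =>
        (v (finSumFinEquiv (Sum.inr j)) = 1 ∧ b (g j % q) ≤ (Finset.univ.filter fun j' : Fin N =>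
            g j' % q = g j % q ∧ v (finSumFinEquiv (Sum.inr j')) = 1 ∧
              (v (finSumFinEquiv (Sum.inl (finProdFinEquiv (j', j)))) = -1 ∨
                (v (finSumFinEquiv (Sum.inl (finProdFinEquiv (j', j)))) = 0 ∧ j' < j))).card) ∨
        (v (finSumFinEquiv (Sum.inr j)) = -1 ∧ (Finset.univ.filter fun j' : Fin N =>
            g j' % q = g j % q ∧ v (finSumFinEquiv (Sum.inr j')) = -1 ∧
              (v (finSumFinEquiv (Sum.inl (finProdFinEquiv (j', j)))) = 1 ∨
                (v (finSumFinEquiv (Sum.inl (finProdFinEquiv (j', j)))) = 0 ∧ j' < j))).card <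
          a (g j % q)) := by
  simp only [hvs, hvp, sign_eq_one_iff, sign_eq_neg_one_iff, sign_eq_zero_iff, sub_pos, sub_neg, sub_eq_zero]

/-- **Every vertex is the point of a canonical set.**  For nonzero exponents `d j`, weights `g j`, a modulus
`q ≥ 1` and a residue `r`, every extreme point `e` of the convex hull of
`X = {Σ_{j ∈ J} d j : Σ_J g j ≡ r (mod q)}` is `Σ_{j ∈ canon c a b} d j` for the values `c j = ⟨w, d j⟩ ≠ 0` of
a strictly exposing direction `w` generic for `{0} ∪ {d j}` (`stub_exposedGenericDirection`) and parameters
`a b : ℕ → ℕ` with `a h, b h < q` everywhere and `a h = b h = 0` for `q ≤ h`: `e = Σ_{J₀} d j` with `J₀`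
admissible maximising `Σ_J c j` among admissible sets (heights of subset sums are sums of values), the normal
form `hNF` yields `a`, `b` with `canon c a b` admissible of the same value (and `a h + b h ≤ Σ_{h < q} < q` for
`h < q`), and a strictly exposed maximum is attained at `e` only. [folklore] -/
theorem extremePoint_eq_canonical (N q r : ℕ) (hq : 1 ≤ q) (g : Fin N → ℕ)
    (d : Fin N → (Fin 2 →₀ ℕ)) (hd : ∀ j, d j ≠ 0)
    (canon : (Fin N → ℝ) → (ℕ → ℕ) → (ℕ → ℕ) → Finset (Fin N))
    (hNF : ∀ (c : Fin N → ℝ), (∀ j, c j ≠ 0) → ∀ J : Finset (Fin N), (∑ j ∈ J, g j) % q = r % q →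
        (∀ J' : Finset (Fin N), (∑ j ∈ J', g j) % q = r % q → ∑ j ∈ J', c j ≤ ∑ j ∈ J, c j) →
        ∃ a b : ℕ → ℕ, (∑ h ∈ Finset.range q, (a h + b h) < q) ∧ (∀ h, q ≤ h → a h = 0 ∧ b h = 0) ∧
          (∑ j ∈ canon c a b, g j) % q = r % q ∧ ∑ j ∈ canon c a b, c j = ∑ j ∈ J, c j)
    (e : Fin 2 → ℝ)
    (he : e ∈ Set.extremePoints ℝ
      (convexHull ℝ ((fun e : Fin 2 →₀ ℕ => fun i : Fin 2 => ((e i : ℕ) : ℝ)) ''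
        (((Finset.univ.filter fun J : Finset (Fin N) => (∑ j ∈ J, g j) % q = r % q).image
          fun J => ∑ j ∈ J, d j : Finset (Fin 2 →₀ ℕ)) : Set (Fin 2 →₀ ℕ))))) :
    ∃ (w : Fin 2 → ℝ) (c : Fin N → ℝ) (a b : ℕ → ℕ),
      (∀ j, c j = ∑ i, w i * ((d j i : ℕ) : ℝ)) ∧
      (∀ h, a h < q ∧ b h < q) ∧ (∀ h, q ≤ h → a h = 0 ∧ b h = 0) ∧
      e = fun i => (((∑ j ∈ canon c a b, d j) i : ℕ) : ℝ) := by
  classical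
  obtain ⟨w, e₀, he₀X, rfl, hexp, hinjT⟩ :=
    NewtonUnitEquationsDissociatedUniform.stub_exposedGenericDirection _ (insert 0 (Finset.univ.image d)) e he
  obtain ⟨c, hc⟩ : ∃ c : Fin N → ℝ, ∀ j, c j = ∑ i, w i * ((d j i : ℕ) : ℝ) := ⟨_, fun _ => rfl⟩
  -- heights of subset sums are sums of values
  have hlin : ∀ J : Finset (Fin N), ∑ i, w i * (((∑ j ∈ J, d j) i : ℕ) : ℝ) = ∑ j ∈ J, c j := by
    intro J
    simp only [Finsupp.finsetSum_apply, Nat.cast_sum, Finset.mul_sum, hc]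
    exact Finset.sum_comm
  -- the values are nonzero: the height separates `d j ∈ T` from `0 ∈ T`
  have hc0 : ∀ j, c j ≠ 0 := by
    intro j hj
    refine hd j (hinjT
      (Finset.mem_coe.2 (Finset.mem_insert_of_mem (Finset.mem_image_of_mem d (Finset.mem_univ j))))
      (Finset.mem_coe.2 (Finset.mem_insert_self 0 _)) ?_)
    dsimp only
    rw [← hc j, hj]
    simp
  -- the exposed vertex is an admissible subset sum of maximal value
  obtain ⟨J₀, hJ₀, rfl⟩ := Finset.mem_image.1 he₀X
  have hJ₀adm : (∑ j ∈ J₀, g j) % q = r % q := (Finset.mem_filter.1 hJ₀).2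
  have hmax : ∀ J' : Finset (Fin N), (∑ j ∈ J', g j) % q = r % q → ∑ j ∈ J', c j ≤ ∑ j ∈ J₀, c j := by
    intro J' hJ'
    by_cases heq : ∑ j ∈ J', d j = ∑ j ∈ J₀, d j
    · exact le_of_eq (by rw [← hlin, ← hlin, heq])
    · have hlt := hexp _ (Finset.mem_image.2 ⟨J', Finset.mem_filter.2 ⟨Finset.mem_univ _, hJ'⟩, rfl⟩) heq
      rw [hlin, hlin] at hlt
      exact hlt.le
  -- a maximiser's point is the vertex, by strict exposure
  have huniq : ∀ K : Finset (Fin N), (∑ j ∈ K, g j) % q = r % q → ∑ j ∈ K, c j = ∑ j ∈ J₀, c j →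
      (fun i : Fin 2 => (((∑ j ∈ J₀, d j) i : ℕ) : ℝ)) = fun i => (((∑ j ∈ K, d j) i : ℕ) : ℝ) := by
    intro K hK hKsum
    by_contra hne
    have hne' : ∑ j ∈ K, d j ≠ ∑ j ∈ J₀, d j := fun h => hne (by rw [h])
    have hlt := hexp _ (Finset.mem_image.2 ⟨K, Finset.mem_filter.2 ⟨Finset.mem_univ _, hK⟩, rfl⟩) hne'
    rw [hlin, hlin, hKsum] at hlt
    exact lt_irrefl _ hlt
  -- the normal form: a canonical admissible set of the same value, with small parameters
  obtain ⟨a, b, hab, hvan, hKadm, hKsum⟩ := hNF c hc0 J₀ hJ₀adm hmax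
  have hlt : ∀ h, a h < q ∧ b h < q := by
    intro h
    rcases Nat.lt_or_ge h q with hh | hh
    · have hle : a h + b h ≤ ∑ h ∈ Finset.range q, (a h + b h) :=
        Finset.single_le_sum (f := fun h => a h + b h) (fun _ _ => Nat.zero_le _) (Finset.mem_range.2 hh)
      exact ⟨by omega, by omega⟩
    · exact ⟨(hvan h hh).1.trans_lt (Nat.lt_of_succ_le hq), (hvan h hh).2.trans_lt (Nat.lt_of_succ_le hq)⟩
  exact ⟨w, c, a, b, hc, hlt, hvan, huniq _ hKadm hKsum⟩

end ResidueWeightedHullAux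

/-- **THEOREM G'' (hull vertices of weighted-residue level sets of subset sums are polynomial, from the normal
form), registered stub `stub_residueWeightedHullOfNF` of line `binomial-normal-form`.**  For nonzero exponents
`d j ∈ ℕ²` (`j : Fin N`), natural weights `g j`, a modulus `q ≥ 1` and a residue `r`, granted the exchange
normal form `hNF` for the canonical sets `canon c a b` of `hcanon` (positives of in-class rank `≥ b (g j % q)`,
negatives of in-class rank `< a (g j % q)`, classes `g j % q`), the convex hull of
`X = {Σ_{j ∈ J} d j : Σ_J g j ≡ r (mod q)}` has at most `(4 (N * N + N) + 5) q ^ (2 q)` extreme points.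
Proof: every extreme point is `Σ_{j ∈ canon c a b} d j` for the values `c` of a strictly exposing generic
direction `w` and parameters `a`, `b` with values `< q`, vanishing on `[q, ∞)`
(`ResidueWeightedHullAux.extremePoint_eq_canonical`); the set is determined by the sign vector of the
`N * N + N` functionals `⟨w, d j' - d j⟩`, `⟨w, d j⟩` (`ResidueWeightedHullAux.canonical_eq_of_signs`) — at
most `4 (N * N + N) + 5` of them (`ResidueDesignHullAux.signvec_plane_count`) — and by `(a, b)`, which are
extensions by zero of two functions `Fin q → Fin q` (`q ^ q q ^ q = q ^ (2 q)` of them). [folklore] -/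
theorem stub_residueWeightedHullOfNF (N q r : ℕ) (hq : 1 ≤ q) (g : Fin N → ℕ)
    (d : Fin N → (Fin 2 →₀ ℕ)) (hd : ∀ j, d j ≠ 0)
    (canon : (Fin N → ℝ) → (ℕ → ℕ) → (ℕ → ℕ) → Finset (Fin N))
    (hcanon : ∀ c a b, canon c a b = Finset.univ.filter fun j : Fin N =>
        (0 < c j ∧ b (g j % q) ≤ (Finset.univ.filter fun j' : Fin N =>
            g j' % q = g j % q ∧ 0 < c j' ∧ (c j' < c j ∨ (c j' = c j ∧ j' < j))).card) ∨
        (c j < 0 ∧ (Finset.univ.filter fun j' : Fin N =>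
            g j' % q = g j % q ∧ c j' < 0 ∧ (c j < c j' ∨ (c j' = c j ∧ j' < j))).card < a (g j % q)))
    (hNF : ∀ (c : Fin N → ℝ), (∀ j, c j ≠ 0) → ∀ J : Finset (Fin N), (∑ j ∈ J, g j) % q = r % q →
        (∀ J' : Finset (Fin N), (∑ j ∈ J', g j) % q = r % q → ∑ j ∈ J', c j ≤ ∑ j ∈ J, c j) →
        ∃ a b : ℕ → ℕ, (∑ h ∈ Finset.range q, (a h + b h) < q) ∧ (∀ h, q ≤ h → a h = 0 ∧ b h = 0) ∧
          (∑ j ∈ canon c a b, g j) % q = r % q ∧ ∑ j ∈ canon c a b, c j = ∑ j ∈ J, c j) :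
    (Set.extremePoints ℝ (convexHull ℝ ((fun e : Fin 2 →₀ ℕ => fun i : Fin 2 => ((e i : ℕ) : ℝ)) ''
      (((Finset.univ.filter fun J : Finset (Fin N) => (∑ j ∈ J, g j) % q = r % q).image
        fun J => ∑ j ∈ J, d j : Finset (Fin 2 →₀ ℕ)) : Set (Fin 2 →₀ ℕ))))).ncard ≤
      (4 * (N * N + N) + 5) * q ^ (2 * q) := by
  classical
  -- the `N * N + N` linear functionals `w ↦ ⟨w, d j' - d j⟩` and `w ↦ ⟨w, d j⟩`
  obtain ⟨u, hup, hus⟩ : ∃ u : Fin (N * N + N) → Fin 2 → ℝ,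
      (∀ j' j, u (finSumFinEquiv (Sum.inl (finProdFinEquiv (j', j)))) =
        fun i => ((d j' i : ℕ) : ℝ) - ((d j i : ℕ) : ℝ)) ∧
      (∀ j, u (finSumFinEquiv (Sum.inr j)) = fun i => ((d j i : ℕ) : ℝ)) := by
    refine ⟨fun m => Sum.elim
        (fun (p : Fin (N * N)) (i : Fin 2) =>
          ((d (finProdFinEquiv.symm p).1 i : ℕ) : ℝ) - ((d (finProdFinEquiv.symm p).2 i : ℕ) : ℝ))
        (fun (j : Fin N) (i : Fin 2) => ((d j i : ℕ) : ℝ)) (finSumFinEquiv.symm m),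
      fun j' j => ?_, fun j => ?_⟩
    · simp only [Equiv.symm_apply_apply, Sum.elim_inl]
    · simp only [Equiv.symm_apply_apply, Sum.elim_inr]
  -- the canonical set read off from a sign vector and the parameters
  obtain ⟨F, hF⟩ :
      ∃ F : (Fin (N * N + N) → SignType) → (ℕ → ℕ) → (ℕ → ℕ) → Finset (Fin N), ∀ v a b,
      F v a b = Finset.univ.filter fun j : Fin N =>
        (v (finSumFinEquiv (Sum.inr j)) = 1 ∧ b (g j % q) ≤ (Finset.univ.filter fun j' : Fin N =>
            g j' % q = g j % q ∧ v (finSumFinEquiv (Sum.inr j')) = 1 ∧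
              (v (finSumFinEquiv (Sum.inl (finProdFinEquiv (j', j)))) = -1 ∨
                (v (finSumFinEquiv (Sum.inl (finProdFinEquiv (j', j)))) = 0 ∧ j' < j))).card) ∨
        (v (finSumFinEquiv (Sum.inr j)) = -1 ∧ (Finset.univ.filter fun j' : Fin N =>
            g j' % q = g j % q ∧ v (finSumFinEquiv (Sum.inr j')) = -1 ∧
              (v (finSumFinEquiv (Sum.inl (finProdFinEquiv (j', j)))) = 1 ∨
                (v (finSumFinEquiv (Sum.inl (finProdFinEquiv (j', j)))) = 0 ∧ j' < j))).card <
          a (g j % q)) :=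
    ⟨_, fun _ _ _ => rfl⟩
  -- the parameter box: extensions by zero of functions `Fin q → Fin q`
  obtain ⟨L, hL⟩ : ∃ L : (Fin q → Fin q) → ℕ → ℕ, ∀ a' h,
      L a' h = if hh : h < q then ((a' ⟨h, hh⟩ : Fin q) : ℕ) else 0 := ⟨_, fun _ _ => rfl⟩
  have hlift : ∀ a : ℕ → ℕ, (∀ h, a h < q) → (∀ h, q ≤ h → a h = 0) → ∃ a' : Fin q → Fin q, L a' = a := by
    intro a hlt hvan
    refine ⟨fun i => ⟨a i, hlt i⟩, funext fun h => ?_⟩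
    rw [hL]
    split_ifs with hh
    · rfl
    · exact (hvan h (not_lt.1 hh)).symm
  -- the realised sign vectors
  obtain ⟨V, hV⟩ : ∃ V : Set (Fin (N * N + N) → SignType),
      V = {v | ∃ w : Fin 2 → ℝ, v = fun m => SignType.sign (∑ i, w i * u m i)} := ⟨_, rfl⟩
  have hVcard : V.ncard ≤ 4 * (N * N + N) + 5 := by
    rw [hV]
    exact ResidueDesignHullAux.signvec_plane_count _ u
  -- every vertex is the point of the canonical set of a realised sign vector and parameters in the box
  refine (Set.ncard_le_ncard (t :=
    (fun p : (Fin (N * N + N) → SignType) × ((Fin q → Fin q) × (Fin q → Fin q)) =>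
      fun i : Fin 2 => (((∑ j ∈ F p.1 (L p.2.1) (L p.2.2), d j) i : ℕ) : ℝ)) ''
        (V ×ˢ (Set.univ : Set ((Fin q → Fin q) × (Fin q → Fin q))))) ?_).trans ?_
  · intro e he
    obtain ⟨w, c, a, b, hc, hlt, hvan, he_eq⟩ :=
      ResidueWeightedHullAux.extremePoint_eq_canonical N q r hq g d hd canon hNF e he
    obtain ⟨a', ha'⟩ := hlift a (fun h => (hlt h).1) fun h hh => (hvan h hh).1
    obtain ⟨b', hb'⟩ := hlift b (fun h => (hlt h).2) fun h hh => (hvan h hh).2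
    have hvs : ∀ j, SignType.sign (∑ i, w i * u (finSumFinEquiv (Sum.inr j)) i) = SignType.sign (c j) :=
      fun j => by simp only [hus, hc]
    have hvp : ∀ j' j, SignType.sign (∑ i, w i * u (finSumFinEquiv (Sum.inl (finProdFinEquiv (j', j)))) i) =
        SignType.sign (c j' - c j) := fun j' j => by
      simp only [hup, hc, mul_sub, Finset.sum_sub_distrib]
    have hAeq := ResidueWeightedHullAux.canonical_eq_of_signs N q g c a b
      (fun m => SignType.sign (∑ i, w i * u m i)) hvs hvp
    refine ⟨((fun m => SignType.sign (∑ i, w i * u m i)), a', b'),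
      Set.mk_mem_prod (by rw [hV]; exact ⟨w, rfl⟩) (Set.mem_univ _), ?_⟩
    dsimp only
    rw [ha', hb', hF, ← hAeq, ← hcanon]
    exact he_eq.symm
  -- count
  · calc _ ≤ (V ×ˢ (Set.univ : Set ((Fin q → Fin q) × (Fin q → Fin q)))).ncard := Set.ncard_image_le
      _ = V.ncard * (q ^ q * q ^ q) := by
          rw [Set.ncard_prod, Set.ncard_univ, Nat.card_prod, Nat.card_fun, Nat.card_fin]
      _ ≤ (4 * (N * N + N) + 5) * q ^ (2 * q) := by
          rw [two_mul, pow_add]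
          exact Nat.mul_le_mul_right _ hVcard

end Summit.ValiantsHypothesis.ValiantsHypothesis.Theorems.NewtonUnitEquationsNewtonTauWeak

end
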